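import Summits.CriticalPhenomena.PercolationContinuityZ3.Theorems.PercNearOneGluingNoHeavyLowerTailSahiOneStepWindow
import Summits.CriticalPhenomena.PercolationContinuityZ3.Theorems.PercNearOneGluingNoHeavyLowerTailSahiOneStepCodimThree
import HarnessLib

/-!
# One-step scheme: `(2′)` at codimension three for ALL pairs from WINDOW-good pivots (gen-37 reduction with the gen-39 window step)

Prover prim-ineq-prove-3 gen 39 (`--supports stmt-CriticalPhenomena-4575`; memo `run/shared/lean/prim/prim-ineq-prove-3/FINDING-G39-WINDOW.md`).
No definitions, no sorries; ONE explicit hypothesis.  `osN_threshold_codimThree_nonneg_of_goodPivots` (gen 37) asked for `X̃ ≥ 0 ∧ Ψ ≥ 0` at some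
pivot of every self-hull codimension-3 event; that hypothesis is FALSE (gen 38: exact killers).  The window step (`osN_threshold_window_step`)
weakens it to `X̃ ≥ 0 ∧ Ψ + (1−p_e)(ℓ⁰−ℓ¹)(b¹−b⁰)(ℓ⁰−β⁰) ≥ 0`, which every gen-38 killer satisfies at its apex and which has no known codimension-3
failure (35 M block events, memo §4; it does fail at codimension 4, memo §0(v)).  This file records the weakened conditional theorem.
-/

noncomputable section

namespace Summit.CriticalPhenomena.PercolationContinuityZ3.Theorems

namespace SahiOneStep

open MeasureTheory Finset
open Literature.Probability.Percolation (DeterminedBy determinedBy_iff determinedBy_univ)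
open Literature.Probability.LatticeModels (prodBernoulli sahiE3)
open Literature.Probability.Percolation.DecisionTree (ind)
open SahiE3Sections (determinedBy_section_insert determinedBy_section_sdiff)
open scoped Classical

variable {ι : Type*} [Fintype ι]

/-! ## `(2′)` at codimension three for all pairs from WINDOW-good pivots of self-hull events -/

/-- **`(2′)` AT CODIMENSION THREE FOR ALL PAIRS, CONDITIONALLY ON WINDOW-GOOD PIVOTS OF SELF-HULL EVENTS.**  As
`osN_threshold_codimThree_nonneg_of_goodPivots` (gen 37), with the good-pivot hypothesis `X̃ ≥ 0 ∧ Ψ ≥ 0` weakened to the WINDOW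
`X̃ ≥ 0 ∧ Ψ + (1−p_e)(ℓ⁰−ℓ¹)(b¹−b⁰)(ℓ⁰−β⁰) ≥ 0` of `osN_threshold_window_step`: if every increasing `F`-determined `B ≠ ∅, univ` (`|F| ≥ 4`) that is
its own hull for the slot `{N_F ≥ |F|-3}` has a window-good pivot at the level `|F|-4` on `F ∖ e`, then `0 ≤ n_{N_F ≥ |F|-3}(A,B)` for every
product measure, every increasing `A` and every increasing `F`-determined `B`.  (The gen-38 codimension-3 killers of `X̃ ∧ Ψ` are window-good;
no codimension-3 event without a window-good pivot is known, memo §4.) [this work] -/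
theorem osN_threshold_codimThree_nonneg_of_windowPivots (p : ι → unitInterval)
    (hwin : ∀ (F : Finset ι) (B : Set (Set ι)), 4 ≤ F.card → IsUpperSet B → DeterminedBy B (↑F : Set ι) → B.Nonempty → B ≠ Set.univ →
      {ω : Set ι | ∀ ω' : Set ι, ω ⊆ ω' → ω' ∈ {ω : Set ι | F.card - 3 ≤ (F.filter (· ∈ ω)).card} → ω' ∈ B} = B →
      ∃ e ∈ F,
      (prodBernoulli p).real {ω : Set ι | ((F.erase e).filter (· ∈ ω)).card < F.card - 4} *
          (prodBernoulli p).real ({ω : Set ι | ω \ {e} ∈ B} ∩ {ω : Set ι | ((F.erase e).filter (· ∈ ω)).card < F.card - 4 + 1}) ≤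
        (prodBernoulli p).real {ω : Set ι | ((F.erase e).filter (· ∈ ω)).card < F.card - 4 + 1} *
          (prodBernoulli p).real ({ω : Set ι | insert e ω ∈ B} ∩ {ω : Set ι | ((F.erase e).filter (· ∈ ω)).card < F.card - 4}) ∧
      (prodBernoulli p).real {ω : Set ι | ((F.erase e).filter (· ∈ ω)).card < F.card - 4} *
          (1 - (prodBernoulli p).real {ω : Set ι | insert e ω ∈ B}) *
          ((prodBernoulli p).real {ω : Set ι | ((F.erase e).filter (· ∈ ω)).card < F.card - 4 + 1} *
              (prodBernoulli p).real {ω : Set ι | ω \ {e} ∈ B}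
            - (prodBernoulli p).real ({ω : Set ι | ω \ {e} ∈ B} ∩ {ω : Set ι | ((F.erase e).filter (· ∈ ω)).card < F.card - 4 + 1})) ≤
        (prodBernoulli p).real {ω : Set ι | ((F.erase e).filter (· ∈ ω)).card < F.card - 4 + 1} *
          (1 - (prodBernoulli p).real {ω : Set ι | ω \ {e} ∈ B}) *
          ((prodBernoulli p).real {ω : Set ι | ((F.erase e).filter (· ∈ ω)).card < F.card - 4} *
              (prodBernoulli p).real {ω : Set ι | insert e ω ∈ B}
            - (prodBernoulli p).real ({ω : Set ι | insert e ω ∈ B} ∩ {ω : Set ι | ((F.erase e).filter (· ∈ ω)).card < F.card - 4}))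
        + (1 - p e) * ((prodBernoulli p).real {ω : Set ι | ((F.erase e).filter (· ∈ ω)).card < F.card - 4 + 1}
              - (prodBernoulli p).real {ω : Set ι | ((F.erase e).filter (· ∈ ω)).card < F.card - 4})
          * ((prodBernoulli p).real {ω : Set ι | insert e ω ∈ B} - (prodBernoulli p).real {ω : Set ι | ω \ {e} ∈ B})
          * ((prodBernoulli p).real {ω : Set ι | ((F.erase e).filter (· ∈ ω)).card < F.card - 4 + 1}
              - (prodBernoulli p).real ({ω : Set ι | ω \ {e} ∈ B} ∩ {ω : Set ι | ((F.erase e).filter (· ∈ ω)).card < F.card - 4 + 1})))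
    (F : Finset ι) {A B : Set (Set ι)} (hA : IsUpperSet A) (hB : IsUpperSet B) (hBF : DeterminedBy B (↑F : Set ι)) :
    0 ≤ osN p {ω : Set ι | F.card - 3 ≤ (F.filter (· ∈ ω)).card} (ind A) (ind B) := by
  induction hn : F.card using Nat.strong_induction_on generalizing F A B with
  | _ n ih =>
  subst hn
  by_cases h4 : F.card < 4
  · rw [show F.card - 3 = 0 by omega, threshold_zero, osN_ind_ind_univ]
  push Not at h4
  refine le_trans ?_ (osN_ind_ind_hgen_le_right p (isUpperSet_threshold F (F.card - 3)) hA hB)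
  set Bs : Set (Set ι) := {ω : Set ι | ∀ ω' : Set ι, ω ⊆ ω' → ω' ∈ {ω : Set ι | F.card - 3 ≤ (F.filter (· ∈ ω)).card} → ω' ∈ B}
    with hBs
  have hBsu : IsUpperSet Bs := isUpperSet_hgen _ _
  have hBsF : DeterminedBy Bs (↑F : Set ι) := determinedBy_hgen (determinedBy_threshold F (F.card - 3)) hBF
  have hBss : {ω : Set ι | ∀ ω' : Set ι, ω ⊆ ω' → ω' ∈ {ω : Set ι | F.card - 3 ≤ (F.filter (· ∈ ω)).card} → ω' ∈ Bs} = Bs := by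
    rw [hBs]; exact hgen_hgen_eq _ _
  rcases Bs.eq_empty_or_nonempty with hBe | hBne
  · rw [hBe, osN_ind_ind_empty_right]
  by_cases hBu : Bs = Set.univ
  · rw [hBu, osN_ind_ind_univ_snd]
  obtain ⟨e, heF, hX, hW⟩ := hwin F Bs h4 hBsu hBsF hBne hBu hBss
  have hce : (F.erase e).card = F.card - 1 := Finset.card_erase_of_mem heF
  have hlt : (F.erase e).card < F.card := Finset.card_erase_lt_of_mem heF
  have e3 : (F.erase e).card - 3 = F.card - 4 := by rw [hce]; omega
  have e2 : (F.erase e).card - 2 = F.card - 4 + 1 := by rw [hce]; omega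
  have hcoe : (↑(F.erase e) : Set ι) = (↑F : Set ι) \ {e} := Finset.coe_erase e F
  have hslot : {ω : Set ι | F.card - 3 ≤ (F.filter (· ∈ ω)).card} =
      {ω : Set ι | F.card - 4 + 1 ≤ ((insert e (F.erase e)).filter (· ∈ ω)).card} := by
    rw [Finset.insert_erase heF, show F.card - 4 + 1 = F.card - 3 by omega]
  rw [hslot]
  refine osN_threshold_window_step p (F.notMem_erase e) (F.card - 4) hA hBsu ?_ ?_ ?_ hX hW
  · have h := ih _ hlt (F.erase e) (isUpperSet_section_insert hA e) (isUpperSet_section_insert hBsu e)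
      (by rw [hcoe]; exact determinedBy_section_insert hBsF e) rfl
    rwa [e3] at h
  · have h := osN_threshold_codimTwo_nonneg p (F.erase e) (isUpperSet_section_insert hA e) (isUpperSet_section_sdiff hBsu e)
      (by rw [hcoe]; exact determinedBy_section_sdiff hBsF e)
    rwa [e2] at h
  · have h := osN_threshold_codimTwo_nonneg p (F.erase e) (isUpperSet_section_sdiff hA e) (isUpperSet_section_sdiff hBsu e)
      (by rw [hcoe]; exact determinedBy_section_sdiff hBsF e)
    rwa [e2] at h

end SahiOneStep

end Summit.CriticalPhenomena.PercolationContinuityZ3.Theorems
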